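import Summits.RiemannHypothesis.RiemannHypothesis.Theses.SignCone
import Summits.RiemannHypothesis.RiemannHypothesis.Theorems.SignConePointwiseCertThirteenTenthsData

/-!
# Sketch — first lemmas of the crux ideas for `OscCoherentCore` (stmt-RiemannHypothesis-18013), ideator k=1, round 1

Statements only (they must elaborate; none is proved here).  Binders copy the route item verbatim
(Mathlib primitives: the autocorrelation sum `F`, the Mellin binder `M s = ∫ F(u) e^{(s-1/2)u} du`,
`W_ar = M 0 + M 1 + (1/2π)∫ M(1/2+it) Re ψ(1/4+it/2) dt − F(0) log π`).

* Card A `poisson-jensen-entropy`: `PoissonJensenPolarBound`, `EntropyInequality`.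
* Card B `rung-transfer-near-harmless`: `NearOnlyHarmless`, `RungTransferResidual`.
* Card C `polar-boundedness`: `PolarBounded C`.
-/

noncomputable section

set_option linter.dupNamespace false

open scoped BigOperators ComplexConjugate
open Complex MeasureTheory Set Filter

namespace Summit.RiemannHypothesis.RiemannHypothesis.Cruxes.OscCoherentCore.IdeaSketchK1

open Summit.RiemannHypothesis.RiemannHypothesis.Theses.SignCone
open Summit.RiemannHypothesis.RiemannHypothesis.Theorems.SignCone

/-- The cone hypothesis of the route items (verbatim). -/
def IsConeFamily (a : ℝ) (k : ℕ) (g : Fin k → ℝ → ℂ) : Prop :=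
  ∀ i, (ContDiff ℝ ((⊤ : ℕ∞) : WithTop ℕ∞) (g i) ∧ HasCompactSupport (g i)) ∧ tsupport (g i) ⊆ Set.Icc (-a) a

/-- The autocorrelation sum `F = Σᵢ gᵢ ⋆ g̃ᵢ` (verbatim binder of the route items). -/
def coneF (k : ℕ) (g : Fin k → ℝ → ℂ) : ℝ → ℂ :=
  fun t => ∑ i, MeasureTheory.convolution (g i) (fun u => (starRingEnd ℂ) ((g i) (-u)))
    (ContinuousLinearMap.mul ℂ ℂ) MeasureTheory.MeasureSpace.volume t

/-- The Mellin binder `M s = ∫ F(u) e^{(s - 1/2) u} du` (verbatim). `M 1 = ∫ F e^{u/2}`, `M (1/2 + iy) = F̂(y)`. -/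
def mellinT (F : ℝ → ℂ) : ℂ → ℂ := fun s => ∫ u : ℝ, F u * Complex.exp ((s - 1 / 2) * u)

/-- `Re W_ar(F)` (verbatim conclusion functional of the route items). -/
def reWar (F : ℝ → ℂ) : ℝ :=
  (mellinT F 0 + mellinT F 1 + ((1 / (2 * Real.pi) : ℂ) * (∫ t : ℝ, mellinT F (1 / 2 + t * Complex.I) *
    ((Complex.digamma (1 / 4 + t / 2 * Complex.I)).re : ℂ)) - F 0 * (Real.log Real.pi : ℂ))).re

/-- The archimedean part alone: `arch(F) = Re W_ar(F) − Re (M 0 + M 1)`. -/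
def reArch (F : ℝ → ℂ) : ℝ := reWar F - (mellinT F 0 + mellinT F 1).re

/-- The Poisson (harmonic) measure density of the half-plane at the pole point: `dP = dy / (2π (1/4 + y²))`. -/
def poissonHalf (y : ℝ) : ℝ := 1 / (2 * Real.pi * (1 / 4 + y ^ 2))

/-- The Szegő / Poisson log-integral ("P-entropy") of the spectral density `σ_F(y) = |M(1/2+iy)|`. -/
def logGM (F : ℝ → ℂ) : ℝ := ∫ y : ℝ, Real.log ‖mellinT F (1 / 2 + y * Complex.I)‖ * poissonHalf y

/-- **Card A, first lemma (Poisson–Jensen / inner–outer bound for the polar integral).**  For every test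
family at cutoff `a` with `F ≢ 0`: the P-log-integral converges and
`|∫ F(u) e^{u/2} du| ≤ e^{a} · exp(∫ log|F̂| dP)` — `z ↦ e^{2iaz} ∫ F(u)e^{-izu}du` is in `H^∞(ℂ₊)`, its value at
`z = i/2` is `e^{-a} M 1`, and `|I·O| ≤ |O|` (Mashreghi 2009, Thms 13.10, 13.15). [folklore] -/
def PoissonJensenPolarBound : Prop :=
  ∀ a : ℝ, 0 < a → ∀ (k : ℕ) (g : Fin k → ℝ → ℂ), IsConeFamily a k g →
    let F := coneF k g
    (F 0).re ≠ 0 →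
      Integrable (fun y : ℝ => Real.log ‖mellinT F (1 / 2 + y * Complex.I)‖ * poissonHalf y) ∧
      ‖mellinT F 1‖ ≤ Real.exp a * Real.exp (logGM F)

/-- **Card A, transfer `C⁺_PJ` (entropy inequality on the polar-negative part of the sign cone).**  For
node-nonnegative families whose polar term is negative, the Szegő geometric mean of the spectral density is
exponentially small in the cutoff: `e^{a} GM_P(σ_F) ≤ (Re F(0) + arch(F)) / 2`.  With
`PoissonJensenPolarBound` it implies the unit-slack sign-cone inequality (hence `OscCoherentCore`), since then
`−Re(M 0 + M 1) ≤ 2|M 1| ≤ 2e^{a}GM_P ≤ Re F(0) + arch(F)`. [folklore] -/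
def EntropyInequality : Prop :=
  ∀ a : ℝ, 0 < a → ∀ (k : ℕ) (g : Fin k → ℝ → ℂ), IsConeFamily a k g →
    let F := coneF k g
    (∀ n : ℕ, 2 ≤ n → 0 ≤ (F (Real.log n)).re) →
    (mellinT F 0 + mellinT F 1).re < 0 →
      Real.exp a * Real.exp (logGM F) ≤ ((F 0).re + reArch F) / 2

/-- **Card B, first lemma (rung transfer: near-only oscillation is harmless at EVERY cutoff).**  The kernel-checked
pointwise certificate `pwCert13s` (window `(−13/5, 13/5)`, `χ ≤ 1`) gives the unit-slack inequality for all `a`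
on tests whose real part is non-negative beyond `|t| ≥ 13/5`, node-nonnegative at `n = 3, …, 12`. [folklore] -/
def NearOnlyHarmless : Prop :=
  ∀ a : ℝ, 0 < a → ∀ (k : ℕ) (g : Fin k → ℝ → ℂ), IsConeFamily a k g →
    let F := coneF k g
    (∀ n : ℕ, 2 ≤ n → 0 ≤ (F (Real.log n)).re) →
    (∀ t : ℝ, 13 / 5 ≤ |t| → 0 ≤ (F t).re) →
      -(F 0).re ≤ reWar F

/-- **Card B, residual form.**  For EVERY node-nonnegative family at ANY cutoff, the deficit of the unit-slack
inequality is at most the far-field negativity beyond the certified window weighted by the bare pole kernel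
`(e^{u/2} + e^{−u/2})(1 − χ(u))` (`χ` = the taper of `pwCert13s`, `1 − χ ∈ [0, 2.11]`, `= 1` beyond `5.6`):
arch term and near nodes are paid for by the certificate. [folklore] -/
def RungTransferResidual : Prop :=
  ∀ a : ℝ, 0 < a → ∀ (k : ℕ) (g : Fin k → ℝ → ℂ), IsConeFamily a k g →
    let F := coneF k g
    (∀ n : ℕ, 2 ≤ n → 0 ≤ (F (Real.log n)).re) →
      -(F 0).re - ∫ u in Set.Ioi (13 / 5 : ℝ),
          (Real.exp (u / 2) + Real.exp (-(u / 2))) * (1 - pwCert13s.d.chiR u) * (2 * max 0 (-(F u).re))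
        ≤ reWar F

/-- **Card C (polar boundedness on the sign cone, constant `C`).**  `−Re(M 0 + M 1) ≤ C · Re F(0)` for every
node-nonnegative family at every cutoff.  `¬RH ⇒ ¬ PolarBounded C` for every `C` (magnification: the sign-cone
value `μ(a) → −∞`, while `arch ≥ −5.37·F(0)`), so `PolarBounded C → RiemannHypothesis → OscCoherentCore`. [folklore] -/
def PolarBounded (C : ℝ) : Prop :=
  ∀ a : ℝ, 0 < a → ∀ (k : ℕ) (g : Fin k → ℝ → ℂ), IsConeFamily a k g →
    let F := coneF k g
    (∀ n : ℕ, 2 ≤ n → 0 ≤ (F (Real.log n)).re) →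
      -(mellinT F 0 + mellinT F 1).re ≤ C * (F 0).re

/-- Sanity: the route item is literally `∀ … → -(F 0).re ≤ reWar F` on its class (definitional unfolding). -/
example : OscCoherentCore ↔
    (∀ a : ℝ, 0 < a → 13 / 10 < a → ∀ (k : ℕ) (g : Fin k → ℝ → ℂ), IsConeFamily a k g →
      let F := coneF k g
      (∀ n : ℕ, 2 ≤ n → 0 ≤ (F (Real.log n)).re) →
      ¬ (∃ T : ℝ, 3 ≤ T ∧ ∀ t : ℝ, Real.log 2 ≤ |t| → (F t).re < 0 → T ≤ |t| ∧ |t| ≤ T + Real.log 2) →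
      (∃ t : ℝ, Real.log 2 ≤ |t| ∧ (F t).re < 0) → -(F 0).re ≤ reWar F) :=
  Iff.rfl

/-- `NearOnlyHarmless` settles the near-only sub-class of the core at every cutoff `a > 13/10` (pure logic). -/
theorem oscCoherentCore_nearOnly (h : NearOnlyHarmless) :
    ∀ a : ℝ, 0 < a → 13 / 10 < a → ∀ (k : ℕ) (g : Fin k → ℝ → ℂ), IsConeFamily a k g →
      let F := coneF k g
      (∀ n : ℕ, 2 ≤ n → 0 ≤ (F (Real.log n)).re) →
      (∀ t : ℝ, 13 / 5 ≤ |t| → 0 ≤ (F t).re) → -(F 0).re ≤ reWar F :=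
  fun a ha _ k g hg hn hfar => h a ha k g hg hn hfar

end Summit.RiemannHypothesis.RiemannHypothesis.Cruxes.OscCoherentCore.IdeaSketchK1
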